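import Mathlib.Analysis.Calculus.FDeriv.Mul
import Mathlib.Analysis.Calculus.FDeriv.Pow
import Mathlib.Analysis.Calculus.Deriv.Inv
import Mathlib.Analysis.Calculus.ContDiff.Operations
import Summits.QuantumFields.BalabanUV.Beta.FP.BoxAverageGermHomogeneous

/-!
# `BalabanUV.Beta.FP.BoxAverageGermInvSq` — road «FP» for binder row D1, N7 PLAN v1 §3, row «N7/GERM-x» of `LEAVES-FP.md`, SUPPLEMENT 3: THE
# `d = 4` INSTANCE END TO END — the box–box smearing of the Newton-type kernel `1/|x|₂²` reproduces it to `O(‖z‖⁻⁶)`: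
# `Fintype.card ι = 4 ⟹ ∃ C ≥ 0, ∀ z, 3 ≤ ‖z‖ → |∫_{box}∫_{box} |z + u − v|₂⁻² − |z|₂⁻²| ≤ C/‖z‖⁶`
# (β sub-cell; CROSS-LANE supplier seat `b2b-balaban-gan24-formalise-leaf-04` (G-an2-4 formalisation swarm, gen 36); parts: `FP/BoxAverageMoments`
# p226497, `FP/BoxAverageGerm` p226750, `FP/BoxAverageGermLocal` p227230, `FP/BoxAverageGermHomogeneous` p227529)

NOT IN PRINT AS SUCH; OUR BOOKKEEPING (elementary calculus).  HONEST FRAMING (cell charter, verbatim): «discharging `BetaPertH` makes Bałaban's UV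
stability UNCONDITIONAL — a real constructive-QFT result; it is NOT the continuum limit and NOT the Clay problem.»  HONEST DEPENDENCY (verbatim): «continuum
YM on T⁴ ⇐ BetaPertH ∧ nine spine estimates (0/9 proved); BetaPertH ⇐ (D1) ∧ (D4) ∧ CAP+tail; G-an2-4 gates asym, D1 and NE2/3/4.»  ABSOLUTE RULE (cell,
verbatim): «No internally-minted statement may enter as a cited fact. Every hypothesis is either kernel-proved in this package or a verbatim quotation of a
PUBLISHED theorem with page reference.»  Nothing is cited; no `def`; no `def … : Prop`; Mathlib + parts 1–4 only; NO road input.  It does NOT say that the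
perfect propagator IS `c₄/|ξ|²` box-averaged (that representation, its Lorentz tensor and the slice are the OWNER's N7 §3 claims ∕ N0b-cov) — it is the
germ computation for that kernel IF it is the one; discharges NOTHING of N7 ∕ `hasym` ∕ D1; NOT `BetaPertH`, NOT continuum, NOT Clay.

CONTENT (`ι` finite; `Σ_i x_i²` the EUCLIDEAN square — distinct from Mathlib's sup norm `‖·‖` on `ι → ℝ`, which only enters the region `3 ≤ ‖z‖` and the rate).
* §1 [folklore] `sumSq_eq_zero_iff`, `sumSq_pos`, `contDiff_sumSq`, **`hasFDerivAt_sumSq`** (`D(Σ y_i²)(x) = Σ_i (2x_i) • proj_i`), `gradSumSq_eq`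
  (the gradient map is the continuous bilinear `Σ_i 2 • proj_i ⊗ proj_i`), `gradSumSq_apply`.
* §2 [folklore] **`hasFDerivAt_invSumSq`** (`D(1/Σy²)(x) = −(Σx²)⁻² • Σ(2x_i) proj_i`, `x ≠ 0`), `fderiv_invSumSq_eventuallyEq`, `hasFDerivAt_negInvSq`,
  **`iteratedFDeriv_two_invSumSq`**: `D²(1/Σy²)(x)(v,v) = 8(Σ x_i v_i)²/(Σ x_i²)³ − 2(Σ v_i²)/(Σ x_i²)²` (`iteratedFDeriv_two_apply`, `HasFDerivAt.smul` for the
  CLM-valued gradient, `HasFDerivAt.congr_of_eventuallyEq` off the origin).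
* §3 **`sum_iteratedFDeriv_two_invSumSq_eq_zero`** [folklore]: `card ι = 4 ⟹ Σ_i D²(1/Σy²)(x)(e_i,e_i) = 8/|x|⁴ − 2·4/|x|⁴ = 0` (`x ≠ 0`) — harmonicity of the
  Newton-type kernel in four dimensions; `invSumSq_homogeneous` (degree `−2`), `contDiffOn_invSumSq`; [our object]
  **`exists_abs_boxAvg_invSumSq_sub_le`**: `card ι = 4 ⟹ ∃ C ≥ 0, ∀ z, 3 ≤ ‖z‖ → |∫_{box}∫_{box} (Σ_k (z+u−v)_k²)⁻¹ − (Σ_k z_k²)⁻¹| ≤ C/‖z‖⁶`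
  (`BoxAverageGermHomogeneous.exists_abs_boxAvg_sub_le_of_homogeneous` at `j = 0`).
Provenance: unit `b2b-balaban-gan24-formalise-leaf-04` (gen 36), 2026-08-20; no existing file touched.  0 sorry.
-/

noncomputable section

open Set MeasureTheory Filter Topology
open scoped ContDiff
open Summit.QuantumFields.BalabanUV.Beta.FP.BoxAverageMoments
open Summit.QuantumFields.BalabanUV.Beta.FP.BoxAverageGermHomogeneous

namespace Summit.QuantumFields.BalabanUV.Beta.FP.BoxAverageGermInvSq

variable {ι : Type*} [Fintype ι]

/-! ## §1 The Euclidean square `Σ_i x_i²` on `ι → ℝ` and its derivative -/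

/-- [folklore] `Σ_i x_i² = 0 ↔ x = 0`. -/
theorem sumSq_eq_zero_iff (x : ι → ℝ) : ∑ i, x i ^ 2 = 0 ↔ x = 0 := by
  rw [Finset.sum_eq_zero_iff_of_nonneg (fun i _ => sq_nonneg (x i))]
  constructor
  · intro h; funext i; exact pow_eq_zero_iff (n := 2) (by norm_num) |>.mp (h i (Finset.mem_univ i))
  · intro h i _; simp [h]

/-- [folklore] `0 < Σ_i x_i²` for `x ≠ 0`. -/
theorem sumSq_pos {x : ι → ℝ} (hx : x ≠ 0) : 0 < ∑ i, x i ^ 2 :=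
  lt_of_le_of_ne (Finset.sum_nonneg fun i _ => sq_nonneg (x i)) (fun h => hx ((sumSq_eq_zero_iff x).mp h.symm))

/-- [folklore] The Euclidean square is smooth. -/
theorem contDiff_sumSq {n : WithTop ℕ∞} : ContDiff ℝ n fun x : ι → ℝ => ∑ i, x i ^ 2 :=
  ContDiff.sum fun i _ => (contDiff_apply ℝ ℝ i).pow 2

/-- [folklore] **THE GRADIENT OF `Σ_i x_i²`**: `D(Σ_i y_i²)(x) = Σ_i (2 x_i) • proj_i`. -/
theorem hasFDerivAt_sumSq (x : ι → ℝ) :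
    HasFDerivAt (fun y : ι → ℝ => ∑ i, y i ^ 2) (∑ i, (2 * x i) • (ContinuousLinearMap.proj i : (ι → ℝ) →L[ℝ] ℝ)) x := by
  have h : ∀ i ∈ (Finset.univ : Finset ι), HasFDerivAt (fun y : ι → ℝ => y i ^ 2)
      ((2 * x i) • (ContinuousLinearMap.proj i : (ι → ℝ) →L[ℝ] ℝ)) x := by
    intro i _
    have h1 : HasFDerivAt (fun y : ι → ℝ => y i) (ContinuousLinearMap.proj i : (ι → ℝ) →L[ℝ] ℝ) x :=
      (ContinuousLinearMap.proj i : (ι → ℝ) →L[ℝ] ℝ).hasFDerivAt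
    have h2 := h1.pow 2
    refine h2.congr_fderiv ?_
    simp [pow_one]
  exact HasFDerivAt.fun_sum h

/-- [folklore] The gradient map `x ↦ Σ_i (2 x_i) • proj_i` is the continuous linear map `Σ_i 2 • proj_i ⊗ proj_i`. -/
theorem gradSumSq_eq (x : ι → ℝ) :
    (∑ i, (2 * x i) • (ContinuousLinearMap.proj i : (ι → ℝ) →L[ℝ] ℝ))
      = (∑ i, (2 : ℝ) • (ContinuousLinearMap.proj i : (ι → ℝ) →L[ℝ] ℝ).smulRight
          (ContinuousLinearMap.proj i : (ι → ℝ) →L[ℝ] ℝ)) x := by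
  rw [_root_.sum_apply]
  refine Finset.sum_congr rfl fun i _ => ?_
  rw [_root_.smul_apply, ContinuousLinearMap.smulRight_apply, smul_smul]
  rfl

/-- [folklore] Evaluation of the gradient: `(Σ_i (2 x_i) • proj_i) v = Σ_i 2 x_i v_i`. -/
theorem gradSumSq_apply (x v : ι → ℝ) :
    (∑ i, (2 * x i) • (ContinuousLinearMap.proj i : (ι → ℝ) →L[ℝ] ℝ)) v = ∑ i, 2 * x i * v i := by
  rw [_root_.sum_apply]
  refine Finset.sum_congr rfl fun i _ => ?_
  simp [mul_assoc]


/-! ## §2 The kernel `f x = (Σ_i x_i²)⁻¹`: first and second derivatives off the origin -/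

/-- [folklore] **FIRST DERIVATIVE of `(Σ y_i²)⁻¹`** at `x ≠ 0`: `−(Σ x_i²)⁻² • Σ_i (2 x_i) • proj_i`. -/
theorem hasFDerivAt_invSumSq {x : ι → ℝ} (hx : x ≠ 0) :
    HasFDerivAt (fun y : ι → ℝ => (∑ i, y i ^ 2)⁻¹)
      ((-((∑ i, x i ^ 2) ^ 2)⁻¹) • ∑ i, (2 * x i) • (ContinuousLinearMap.proj i : (ι → ℝ) →L[ℝ] ℝ)) x := by
  have ha : (∑ i, x i ^ 2) ≠ 0 := (sumSq_pos hx).ne'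
  have h := (hasFDerivAt_inv ha).comp x (hasFDerivAt_sumSq x)
  refine h.congr_fderiv ?_
  ext v
  simp only [ContinuousLinearMap.comp_apply, ContinuousLinearMap.toSpanSingleton_apply, smul_apply, smul_eq_mul]
  ring

/-- [folklore] Off the origin, `fderiv` of `(Σ y_i²)⁻¹` is the map `y ↦ −(Σ y_i²)⁻² • Σ_i (2 y_i) • proj_i`. -/
theorem fderiv_invSumSq_eventuallyEq {x : ι → ℝ} (hx : x ≠ 0) :
    fderiv ℝ (fun y : ι → ℝ => (∑ i, y i ^ 2)⁻¹)
      =ᶠ[𝓝 x] fun y => (-((∑ i, y i ^ 2) ^ 2)⁻¹) • ∑ i, (2 * y i) • (ContinuousLinearMap.proj i : (ι → ℝ) →L[ℝ] ℝ) := by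
  have hU : ({0}ᶜ : Set (ι → ℝ)) ∈ 𝓝 x := isOpen_compl_singleton.mem_nhds hx
  filter_upwards [hU] with y hy
  exact (hasFDerivAt_invSumSq hy).fderiv

/-- [folklore] **DERIVATIVE OF THE SCALAR PREFACTOR** `y ↦ −((Σ y_i²)²)⁻¹` at `x ≠ 0`. -/
theorem hasFDerivAt_negInvSq {x : ι → ℝ} (hx : x ≠ 0) :
    HasFDerivAt (fun y : ι → ℝ => -((∑ i, y i ^ 2) ^ 2)⁻¹)
      (((2 * (∑ i, x i ^ 2)) / ((∑ i, x i ^ 2) ^ 2) ^ 2) • ∑ i, (2 * x i) • (ContinuousLinearMap.proj i : (ι → ℝ) →L[ℝ] ℝ)) x := by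
  have ha : (∑ i, x i ^ 2) ≠ 0 := (sumSq_pos hx).ne'
  have h2 : HasFDerivAt (fun y : ι → ℝ => (∑ i, y i ^ 2) ^ 2)
      ((2 • (∑ i, x i ^ 2) ^ (2 - 1)) • ∑ i, (2 * x i) • (ContinuousLinearMap.proj i : (ι → ℝ) →L[ℝ] ℝ)) x :=
    (hasFDerivAt_sumSq x).pow 2
  have h3 := ((hasFDerivAt_inv (pow_ne_zero 2 ha)).comp x h2).neg
  refine h3.congr_fderiv ?_
  ext v
  simp only [neg_apply, ContinuousLinearMap.comp_apply, ContinuousLinearMap.toSpanSingleton_apply,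
    _root_.smul_apply, smul_eq_mul, nsmul_eq_mul, Nat.cast_ofNat, pow_one, Nat.add_one_sub_one]
  ring

/-- [folklore] **THE SECOND DERIVATIVE OF `(Σ y_i²)⁻¹` ON THE DIAGONAL** at `x ≠ 0`:
`D²f(x)(v, v) = 8 (Σ x_i v_i)² / (Σ x_i²)³ − 2 (Σ v_i²) / (Σ x_i²)²`. -/
theorem iteratedFDeriv_two_invSumSq {x : ι → ℝ} (hx : x ≠ 0) (v : ι → ℝ) :
    iteratedFDeriv ℝ 2 (fun y : ι → ℝ => (∑ i, y i ^ 2)⁻¹) x (fun _ => v)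
      = 8 * (∑ i, x i * v i) ^ 2 / (∑ i, x i ^ 2) ^ 3 - 2 * (∑ i, v i ^ 2) / (∑ i, x i ^ 2) ^ 2 := by
  have ha : (∑ i, x i ^ 2) ≠ 0 := (sumSq_pos hx).ne'
  -- the map `y ↦ Σ (2 y_i) • proj_i` is the continuous linear map `B`
  set B : (ι → ℝ) →L[ℝ] (ι → ℝ) →L[ℝ] ℝ :=
    ∑ i, (2 : ℝ) • (ContinuousLinearMap.proj i : (ι → ℝ) →L[ℝ] ℝ).smulRight (ContinuousLinearMap.proj i : (ι → ℝ) →L[ℝ] ℝ)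
    with hB
  have hL : HasFDerivAt (fun y : ι → ℝ => ∑ i, (2 * y i) • (ContinuousLinearMap.proj i : (ι → ℝ) →L[ℝ] ℝ)) B x := by
    have e : (fun y : ι → ℝ => ∑ i, (2 * y i) • (ContinuousLinearMap.proj i : (ι → ℝ) →L[ℝ] ℝ)) = fun y => B y := by
      funext y; rw [hB]; exact gradSumSq_eq y
    rw [e]; exact B.hasFDerivAt
  have hG := (hasFDerivAt_negInvSq hx).smul hL
  have hD2 : HasFDerivAt (fderiv ℝ (fun y : ι → ℝ => (∑ i, y i ^ 2)⁻¹)) _ x :=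
    hG.congr_of_eventuallyEq (fderiv_invSumSq_eventuallyEq hx)
  rw [iteratedFDeriv_two_apply, hD2.fderiv]
  simp only [add_apply, smul_apply, ContinuousLinearMap.smulRight_apply, hB, _root_.sum_apply,
    ContinuousLinearMap.proj_apply, smul_eq_mul]
  have e1 : ∑ i, 2 * x i * v i = 2 * ∑ i, x i * v i := by rw [Finset.mul_sum]; simp [mul_assoc]
  have e2 : ∑ i, (2 : ℝ) * (v i * v i) = 2 * ∑ i, v i ^ 2 := by rw [Finset.mul_sum]; simp [sq]
  rw [e1, e2]
  field_simp
  ring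


/-! ## §3 Dimension four: `1/|x|₂²` is harmonic off the origin; the box-average germ of the `d = 4` Newton-type kernel -/

variable [DecidableEq ι]

/-- [folklore] **`Δ (1/|x|₂²) = 0` OFF THE ORIGIN IN DIMENSION FOUR** (`Fintype.card ι = 4`), in the coordinate form used by the germ lemma:
`Σ_i D²f(x)(e_i, e_i) = Σ_i (8 x_i²/|x|⁶ − 2/|x|⁴) = 8/|x|⁴ − 2·4/|x|⁴ = 0`. -/
theorem sum_iteratedFDeriv_two_invSumSq_eq_zero (hι : Fintype.card ι = 4) {x : ι → ℝ} (hx : x ≠ 0) :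
    ∑ i, iteratedFDeriv ℝ 2 (fun y : ι → ℝ => (∑ k, y k ^ 2)⁻¹) x (fun _ => (Pi.single i (1 : ℝ) : ι → ℝ)) = 0 := by
  have ha : (∑ k, x k ^ 2) ≠ 0 := (sumSq_pos hx).ne'
  have e1 : ∀ i : ι, ∑ k, x k * (Pi.single i (1 : ℝ) : ι → ℝ) k = x i := fun i => by
    simp [Pi.single_apply, Finset.sum_ite_eq', Finset.mem_univ]
  have e2 : ∀ i : ι, ∑ k, ((Pi.single i (1 : ℝ) : ι → ℝ) k) ^ 2 = 1 := fun i => by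
    simp [Pi.single_apply, Finset.sum_ite_eq', Finset.mem_univ]
  simp_rw [iteratedFDeriv_two_invSumSq hx, e1, e2]
  rw [Finset.sum_sub_distrib, Finset.sum_const, Finset.card_univ, hι, ← Finset.sum_div, ← Finset.mul_sum]
  simp only [nsmul_eq_mul, Nat.cast_ofNat, mul_one]
  field_simp
  ring

omit [DecidableEq ι] in
/-- [folklore] `1/|x|₂²` is homogeneous of degree `−2` (written `−(2 + 0)` to fit the germ lemma's `−(2 + j)` at `j = 0`). -/
theorem invSumSq_homogeneous (c : ℝ) (_hc : 0 < c) (x : ι → ℝ) :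
    (fun y : ι → ℝ => (∑ k, y k ^ 2)⁻¹) (c • x) = c ^ (-(2 + ((0 : ℕ) : ℤ))) • (fun y : ι → ℝ => (∑ k, y k ^ 2)⁻¹) x := by
  simp only [Pi.smul_apply, smul_eq_mul, mul_pow, ← Finset.mul_sum, mul_inv, Nat.cast_zero, add_zero, zpow_neg]
  congr 1

omit [DecidableEq ι] in
/-- [folklore] `1/|x|₂²` is smooth off the origin. -/
theorem contDiffOn_invSumSq : ContDiffOn ℝ ∞ (fun y : ι → ℝ => (∑ k, y k ^ 2)⁻¹) {0}ᶜ :=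
  contDiff_sumSq.contDiffOn.inv fun _ hx => (sumSq_pos hx).ne'

/-- **THE BOX-AVERAGE GERM OF THE `d = 4` NEWTON-TYPE KERNEL `1/|x|₂²`** (`Fintype.card ι = 4`; sup norm `‖·‖` on `ι → ℝ` in the hypothesis and the
rate): `∃ C ≥ 0, ∀ z, 3 ≤ ‖z‖ → |∫_{box} ∫_{box} |z + u − v|₂⁻² du dv − |z|₂⁻²| ≤ C / ‖z‖⁶` — the leading (`j = 0`, Feynman-type tensor) instance of the
row's GERM-x statement, END TO END in the kernel (homogeneity + smoothness off `0` + harmonicity in `d = 4` ⟶ `BoxAverageGermHomogeneous`). [our object] -/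
theorem exists_abs_boxAvg_invSumSq_sub_le (hι : Fintype.card ι = 4) :
    ∃ C : ℝ, 0 ≤ C ∧ ∀ z : ι → ℝ, 3 ≤ ‖z‖ →
      |(∫ u in box ι, ∫ v in box ι, (∑ k, (z + u - v) k ^ 2)⁻¹) - (∑ k, z k ^ 2)⁻¹| ≤ C / ‖z‖ ^ 6 := by
  have hΔ : ∀ x : ι → ℝ, 2 ≤ ‖x‖ →
      ∑ i, iteratedFDeriv ℝ 2 (fun y : ι → ℝ => (∑ k, y k ^ 2)⁻¹) x (fun _ => (Pi.single i (1 : ℝ) : ι → ℝ)) = 0 := fun x hx =>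
    sum_iteratedFDeriv_two_invSumSq_eq_zero hι (by intro h0; rw [h0, norm_zero] at hx; exact absurd hx (by norm_num))
  obtain ⟨C, hC, h⟩ := exists_abs_boxAvg_sub_le_of_homogeneous (j := 0) (invSumSq_homogeneous (ι := ι)) contDiffOn_invSumSq hΔ
  refine ⟨C, hC, fun z hz => ?_⟩
  simpa using h z hz

end Summit.QuantumFields.BalabanUV.Beta.FP.BoxAverageGermInvSq

end
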